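import Mathlib.Analysis.SpecialFunctions.Pow.Deriv
import Literature.Geometry.Lorentzian.MinkowskiRadialMultiplier
import HarnessLib

/-!
# The Dafermos–Rodnianski large-`r` current `X = (1 − r^{−δ}) ∂_r`, `w = 4/r − 4 r^{−1−δ} +
# 2δ r^{−1−2δ}` on Minkowski space: coercivity of the bulk for `r ≥ 2^{1/δ}`

(family `gr`; infrastructure for the large-`r` estimate behind statement **gr.S24** —
Dafermos–Rodnianski–Shlapentokh-Rothman, arXiv:1402.7034, Prop. 4.6.1, whose proof is that of
Dafermos–Rodnianski, arXiv:1010.5132, §6 ("A current for large `r`"); the Minkowski model case, in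
the coefficient-field framework of `KerrSchild.waveOperator`; namespace
`Literature.Geometry.Lorentzian.KerrSchild`)

Dafermos–Rodnianski (arXiv:1010.5132, §6) take `X = f(r*)∂_r`,
`w = 2f' + 4 (1 − 2M/r) f/r − 2δ (1 − 2M/r) f/r^{1+δ}`, `f = χ (1 − r^{−δ})`, and record that for
`R` large the bulk of `J^{X,w}` satisfies
`K^{X,w} ≥ b(δ) ( r^{−1−δ} (∂_rΨ)² + r^{−1−δ} (∂_tΨ)² + r^{−1} |∇̸Ψ|² + r^{−3−δ} Ψ² )` on `{r ≥ R}`,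
"and that this inequality is preserved when `X`, `w` are defined for `g_{M,a}`". This file proves
the inequality in the Minkowski model `M = 0` (where `r* = r`, `χ = 1` on `{r ≥ R}`), with the
explicit threshold `R = 2^{1/δ}` and explicit constants, in the form adapted to
`KerrSchild.sum_fderiv_modifiedCurrent` (bulk of `J^X + ¼ L_ϖ` = `K^X + ¼ ϖ Q − ⅛ (□ϖ) w²` plus the
source term): with `s = |y⃗|²`, `X⁰ = 0`, `X^i = (s^{−1/2} − s^{−(1+δ)/2}) y_i` (`= (1 − r^{−δ}) ∂_r`),
`¼ ϖ = r^{−1} − r^{−1−δ} + (δ/2) r^{−1−2δ}` and `0 < δ ≤ 1`, `r ≥ 2^{1/δ}`: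

* `KerrSchild.largeR_firstOrder_lower_bound` —
  `K^X + ¼ ϖ Q ≥ (δ/4) r^{−1−δ} ∑_μ (∂_μ w)²` (the first-order bulk is
  `(f' − ε) (∂_r w)² + (f/r − ε) |∇̸w|² + ε (∂_t w)²`, `ε = δ f /(2 r^{1+δ})`, as printed for
  `M = 0`; the algebra is `largeR_algebra`);
* `KerrSchild.largeR_zerothOrder_lower_bound` — `−⅛ □_η ϖ ≥ (δ/4) r^{−3−δ}`
  (`□_η ϖ = −4δ(1+δ) r^{−3−δ} + 4δ²(1+2δ) r^{−3−2δ}`, `waveOperator_eta_largeRWeight`);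

so that the bulk of the modified current dominates
`(δ/4) r^{−1−δ} |∂w|² + (δ/4) r^{−3−δ} w²` on `{r ≥ 2^{1/δ}}` — the displayed inequality of
loc. cit. with `b(δ) = δ/4`, apart from the stronger angular weight `r^{−1}|∇̸w|²` (the algebra,
`largeR_algebra`, keeps `(δ/2)(1+u) r^{−1−δ}` in front of `|p⃗|²`; the angular refinement is not
recorded here).

## References

* M. Dafermos, I. Rodnianski, arXiv:1010.5132, §6 (key `DafermosRodnianski2010`).
* M. Dafermos, I. Rodnianski, Y. Shlapentokh-Rothman, arXiv:1402.7034 = Ann. of Math. 183 (2016),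
  Prop. 4.6.1 (key `DafermosRodnianskiShlapentokhrothman2014`).
-/

noncomputable section

open Set Filter
open scoped ContDiff Topology

namespace Literature.Geometry.Lorentzian

namespace KerrSchild

/-! ### Real-power bookkeeping at `s = r² > 0` -/

/-- `s · s^{a − 1} = s^a` for `s > 0`. [folklore] -/
theorem mul_rpow_sub_one {s : ℝ} (hs : 0 < s) (a : ℝ) : s * s ^ (a - 1) = s ^ a := by
  rw [Real.rpow_sub_one hs.ne', mul_div_cancel₀ _ hs.ne']

/-- For `r ≥ 2^{1/δ}` (`δ > 0`): `r^{−δ} ≤ ½`. [folklore] -/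
theorem rpow_neg_le_half {δ r : ℝ} (hδ : 0 < δ) (hr : (2 : ℝ) ^ (1 / δ) ≤ r) : r ^ (-δ) ≤ 1 / 2 := by
  have h2 : 0 < (2 : ℝ) ^ (1 / δ) := Real.rpow_pos_of_pos (by norm_num) _
  calc r ^ (-δ) ≤ ((2 : ℝ) ^ (1 / δ)) ^ (-δ) :=
        Real.rpow_le_rpow_of_nonpos h2 hr (by linarith)
    _ = 1 / 2 := by
        rw [← Real.rpow_mul (by norm_num : (0 : ℝ) ≤ 2), show 1 / δ * -δ = -1 by field_simp,
          Real.rpow_neg_one]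
        norm_num

/-! ### The seed function `g_δ(s) = s^{−1/2} − s^{−(1+δ)/2}` and its derivative -/

/-- Derivative of the seed `g(t) = t^{−1/2} − t^{−(1+δ)/2}` at `t > 0`. [folklore] -/
theorem hasDerivAt_largeRSeed (δ : ℝ) {t : ℝ} (ht : 0 < t) :
    HasDerivAt (fun u : ℝ ↦ u ^ (-(1 / 2 : ℝ)) - u ^ (-(1 + δ) / 2))
      (-(1 / 2 : ℝ) * t ^ (-(1 / 2 : ℝ) - 1) - -(1 + δ) / 2 * t ^ (-(1 + δ) / 2 - 1)) t :=
  (Real.hasDerivAt_rpow_const (Or.inl ht.ne')).sub (Real.hasDerivAt_rpow_const (Or.inl ht.ne'))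

/-! ### The first-order bulk: exact form and coercivity -/

/-- **The algebra of the DR large-`r` bulk.** With `A = r^{−1}`, `B = r^{−1−δ}`, `u = r^{−δ}`
(`B = A u`), `g = A − B`, `s g' = −½A + ((1+δ)/2)B`, `ε = (δ/2)(1 − u)B`, one has
`2g'(y⃗·p⃗)² + g|p⃗|² − ½(2sg' + 3g)Q + (A − B + (δ/2)uB) Q = 2g'(y⃗·p⃗)² + (g − ε)|p⃗|² + ε p₀²`,
and for `0 < δ ≤ 1`, `u ≤ ½` this is `≥ (δ/4) B (p₀² + |p⃗|²)` whenever `(y⃗·p⃗)² ≤ s |p⃗|²`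
(Cauchy–Schwarz; the coefficient `2g' = A(−1 + (1+δ)u)/s` is non-positive).
[cite: DafermosRodnianski2010, §6] -/
theorem largeR_algebra {δ A B u s g2 yp2 P2 p02 : ℝ} (hδ0 : 0 < δ) (hδ1 : δ ≤ 1) (hA : 0 < A)
    (hu0 : 0 < u) (hu : u ≤ 1 / 2) (hBA : B = A * u) (hs : 0 < s)
    (hg2 : s * g2 = -A + (1 + δ) * B) (hyp : yp2 ≤ s * P2) (hyp0 : 0 ≤ yp2) (hp0 : 0 ≤ p02) :
    δ / 4 * B * (p02 + P2) ≤
      g2 * yp2 + (A - B) * P2 - 2⁻¹ * (s * g2 + 3 * (A - B)) * (-p02 + P2) +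
        (A - B + δ / 2 * (u * B)) * (-p02 + P2) := by
  have hB : 0 < B := by rw [hBA]; exact mul_pos hA hu0
  have hP2 : 0 ≤ P2 := by
    by_contra h
    rw [not_le] at h
    nlinarith [mul_neg_of_pos_of_neg hs h]
  -- the coefficient of `yp2` is non-positive: replace `yp2` by its upper bound `s P2`
  have hcoef : g2 ≤ 0 := by
    have h1 : (1 + δ) * u ≤ 1 := by nlinarith
    have h2 : s * g2 ≤ 0 := by
      rw [hg2, hBA]
      nlinarith [mul_le_mul_of_nonneg_left h1 hA.le]
    by_contra h
    rw [not_le] at h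
    nlinarith [mul_pos hs h]
  have hstep : g2 * (s * P2) ≤ g2 * yp2 := mul_le_mul_of_nonpos_left hyp hcoef
  -- after the replacement everything is a positive combination
  have hrest : δ / 4 * B * (p02 + P2) ≤
      g2 * (s * P2) + (A - B) * P2 - 2⁻¹ * (s * g2 + 3 * (A - B)) * (-p02 + P2) +
        (A - B + δ / 2 * (u * B)) * (-p02 + P2) := by
    have e1 : g2 * (s * P2) = (-A + (1 + δ) * B) * P2 := by rw [← hg2]; ring
    rw [e1, hg2]
    nlinarith [mul_nonneg hB.le hP2, mul_nonneg hB.le hp0, mul_nonneg (mul_nonneg hB.le hP2) hu0.le,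
      mul_nonneg (mul_nonneg hB.le hp0) (by linarith : (0 : ℝ) ≤ 1 / 2 - u),
      mul_nonneg (mul_nonneg hB.le hP2) hδ0.le, mul_nonneg (mul_nonneg hB.le hp0) hδ0.le,
      mul_nonneg (mul_nonneg (mul_nonneg hB.le hP2) hu0.le) hδ0.le,
      mul_nonneg (mul_nonneg (mul_nonneg hB.le hp0) (by linarith : (0 : ℝ) ≤ 1 / 2 - u)) hδ0.le]
  linarith

/-- **Coercivity of the first-order part of the DR large-`r` bulk on Minkowski space.** Let
`0 < δ ≤ 1` and `r = |y⃗|(x) ≥ 2^{1/δ}`. For the multiplier `X⁰ = 0`,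
`X^i = (s^{−1/2} − s^{−(1+δ)/2}) y_i` (`s = |y⃗|²`; i.e. `X = (1 − r^{−δ})∂_r`) and the Minkowski
coefficients `η`, with `p_μ = ∂_μw(x)` and `Q = −p₀² + |p⃗|²`,
`K^X(x) + (r^{−1} − r^{−1−δ} + (δ/2) r^{−1−2δ}) Q ≥ (δ/4) r^{−1−δ} ∑_μ p_μ²`
— the `M = 0` case of Dafermos–Rodnianski arXiv:1010.5132, §6, `K^{X,w} ≥ b(δ)(r^{−1−δ}(∂_rΨ)² +
r^{−1−δ}(∂_tΨ)² + r^{−1}|∇̸Ψ|² + …)`, with the coefficient `¼ϖ = r^{−1} − r^{−1−δ} + (δ/2)r^{−1−2δ}`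
of `Q` being that of the modified current `J^X + ¼ L_ϖ` (`KerrSchild.sum_fderiv_modifiedCurrent`),
`ϖ = 2f' + 4f/r − 2δ f/r^{1+δ}`, `f = 1 − r^{−δ}`. [cite: DafermosRodnianski2010, §6] -/
theorem largeR_firstOrder_lower_bound {δ : ℝ} (hδ0 : 0 < δ) (hδ1 : δ ≤ 1) (w : E4 → ℝ) {x : E4}
    (hx : (2 : ℝ) ^ (1 / δ) ≤ E4.spatialNorm x) :
    δ / 4 * E4.spatialNorm x ^ (-1 - δ) * ∑ μ, fderiv ℝ w x (E4.basisVector μ) ^ 2 ≤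
      multiplierBulk (fun _ ↦ Kerr.etaComp)
          (fun y α ↦ if α = 0 then (0 : ℝ) else
            ((E4.spatialNorm y ^ 2) ^ (-(1 / 2 : ℝ)) - (E4.spatialNorm y ^ 2) ^ (-(1 + δ) / 2)) * y α)
          w x +
        (E4.spatialNorm x ^ (-1 : ℝ) - E4.spatialNorm x ^ (-1 - δ) +
            δ / 2 * E4.spatialNorm x ^ (-1 - 2 * δ)) *
          (-fderiv ℝ w x (E4.basisVector 0) ^ 2 + (fderiv ℝ w x (E4.basisVector 1) ^ 2 +
            fderiv ℝ w x (E4.basisVector 2) ^ 2 + fderiv ℝ w x (E4.basisVector 3) ^ 2)) := by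
  -- positivity of `r` and `s`
  have h2 : 0 < (2 : ℝ) ^ (1 / δ) := Real.rpow_pos_of_pos (by norm_num) _
  have hr : 0 < E4.spatialNorm x := h2.trans_le hx
  set r : ℝ := E4.spatialNorm x with hr_def
  have hs : 0 < r ^ 2 := by positivity
  -- the bulk from `multiplierBulk_eta_radial`
  have hg := hasDerivAt_largeRSeed δ hs
  rw [multiplierBulk_eta_radial w hg]
  simp only [← hr_def]
  -- the quantities `A = r⁻¹`, `B = r^{-1-δ}`, `u = r^{-δ}`
  have hA' : (r ^ 2) ^ (-(1 / 2 : ℝ)) = r ^ (-1 : ℝ) := by rw [← Real.rpow_two, ← Real.rpow_mul hr.le]; norm_num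
  have hB' : (r ^ 2) ^ (-(1 + δ) / 2) = r ^ (-1 - δ) := by
    rw [← Real.rpow_two, ← Real.rpow_mul hr.le]; ring_nf
  have hC' : r ^ (-δ) * r ^ (-1 - δ) = r ^ (-1 - 2 * δ) := by
    rw [← Real.rpow_add hr]; ring_nf
  have hBA : r ^ (-1 - δ) = r ^ (-1 : ℝ) * r ^ (-δ) := by
    rw [← Real.rpow_add hr]; ring_nf
  -- the derivative: `s g' = -½ A + ((1+δ)/2) B`
  have hg2 : r ^ 2 * (2 * (-(1 / 2 : ℝ) * (r ^ 2) ^ (-(1 / 2 : ℝ) - 1) -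
      -(1 + δ) / 2 * (r ^ 2) ^ (-(1 + δ) / 2 - 1))) =
      -r ^ (-1 : ℝ) + (1 + δ) * r ^ (-1 - δ) := by
    have e1 : r ^ 2 * (r ^ 2) ^ (-(1 / 2 : ℝ) - 1) = r ^ (-1 : ℝ) := by
      rw [mul_rpow_sub_one hs, hA']
    have e2 : r ^ 2 * (r ^ 2) ^ (-(1 + δ) / 2 - 1) = r ^ (-1 - δ) := by
      rw [mul_rpow_sub_one hs, hB']
    have : r ^ 2 * (2 * (-(1 / 2 : ℝ) * (r ^ 2) ^ (-(1 / 2 : ℝ) - 1) -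
        -(1 + δ) / 2 * (r ^ 2) ^ (-(1 + δ) / 2 - 1))) =
        -(r ^ 2 * (r ^ 2) ^ (-(1 / 2 : ℝ) - 1)) + (1 + δ) * (r ^ 2 * (r ^ 2) ^ (-(1 + δ) / 2 - 1)) := by
      ring
    rw [this, e1, e2]
  -- Cauchy–Schwarz and the sum of squares
  obtain ⟨p, hp⟩ : ∃ p : Fin 4 → ℝ, ∀ κ, fderiv ℝ w x (E4.basisVector κ) = p κ := ⟨_, fun _ ↦ rfl⟩
  simp only [hp, Fin.sum_univ_four, Fin.isValue, hA', hB']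
  have hCS : (x 1 * p 1 + x 2 * p 2 + x 3 * p 3) ^ 2 ≤ r ^ 2 * (p 1 ^ 2 + p 2 ^ 2 + p 3 ^ 2) := by
    rw [hr_def, E4.spatialNorm_sq]
    nlinarith [sq_nonneg (x 1 * p 2 - x 2 * p 1), sq_nonneg (x 1 * p 3 - x 3 * p 1),
      sq_nonneg (x 2 * p 3 - x 3 * p 2)]
  have halg := largeR_algebra (A := r ^ (-1 : ℝ)) (B := r ^ (-1 - δ)) (u := r ^ (-δ)) (s := r ^ 2)
    (g2 := 2 * (-(1 / 2 : ℝ) * (r ^ 2) ^ (-(1 / 2 : ℝ) - 1) -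
      -(1 + δ) / 2 * (r ^ 2) ^ (-(1 + δ) / 2 - 1)))
    (yp2 := (x 1 * p 1 + x 2 * p 2 + x 3 * p 3) ^ 2) (P2 := p 1 ^ 2 + p 2 ^ 2 + p 3 ^ 2)
    (p02 := p 0 ^ 2) hδ0 hδ1 (Real.rpow_pos_of_pos hr _) (Real.rpow_pos_of_pos hr _)
    (rpow_neg_le_half hδ0 hx) hBA hs hg2 hCS (sq_nonneg _) (sq_nonneg _)
  rw [hC'] at halg
  have e : p 0 ^ 2 + (p 1 ^ 2 + p 2 ^ 2 + p 3 ^ 2) = p 0 ^ 2 + p 1 ^ 2 + p 2 ^ 2 + p 3 ^ 2 := by ring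
  calc δ / 4 * r ^ (-1 - δ) * (p 0 ^ 2 + p 1 ^ 2 + p 2 ^ 2 + p 3 ^ 2)
      = δ / 4 * r ^ (-1 - δ) * (p 0 ^ 2 + (p 1 ^ 2 + p 2 ^ 2 + p 3 ^ 2)) := by ring
    _ ≤ _ := halg
    _ = _ := by ring

/-! ### The zeroth-order term: `□_η ϖ` for the weight `ϖ = 4/r − 4r^{−1−δ} + 2δ r^{−1−2δ}` -/

/-- **`□_η` of a pure power of `s`**: `□_η [s^{−a}] = 2a(2a − 1) s^{−a−1}` for `s = |y⃗|²(x) > 0`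
(`Δ r^{−2a} = 2a(2a−1) r^{−2a−2}` in `ℝ³`; in particular `a = ½` gives the harmonic `1/r`).
[cite: DafermosRodnianski2008, §4.1] -/
theorem waveOperator_eta_rpow (a : ℝ) {x : E4} (hx : 0 < E4.spatialNorm x) :
    waveOperator (fun _ ↦ Kerr.etaComp) (fun y ↦ (E4.spatialNorm y ^ 2) ^ (-a)) x =
      2 * a * (2 * a - 1) * (E4.spatialNorm x ^ 2) ^ (-a - 1) := by
  set s : ℝ := E4.spatialNorm x ^ 2 with hs_def
  have hs : 0 < s := by positivity
  have hφ : ContDiffAt ℝ 2 (fun t : ℝ ↦ t ^ (-a)) s := Real.contDiffAt_rpow_const_of_ne hs.ne'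
  rw [waveOperator_eta_radial hφ]
  simp only [← hs_def]
  -- first derivative near `s`, second derivative at `s`
  have hd1 : deriv (fun t : ℝ ↦ t ^ (-a)) =ᶠ[𝓝 s] fun t ↦ -a * t ^ (-a - 1) := by
    filter_upwards [Ioi_mem_nhds hs] with t ht
    exact (Real.hasDerivAt_rpow_const (Or.inl (ne_of_gt ht))).deriv
  have hφ' : deriv (fun t : ℝ ↦ t ^ (-a)) s = -a * s ^ (-a - 1) :=
    (Real.hasDerivAt_rpow_const (Or.inl hs.ne')).deriv
  have hφ'' : deriv (deriv (fun t : ℝ ↦ t ^ (-a))) s = -a * ((-a - 1) * s ^ (-a - 1 - 1)) := by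
    rw [hd1.deriv_eq]
    exact ((Real.hasDerivAt_rpow_const (Or.inl hs.ne')).const_mul (-a)).deriv
  rw [hφ', hφ'']
  have e : s * s ^ (-a - 1 - 1) = s ^ (-a - 1) := mul_rpow_sub_one hs _
  have : 4 * s * (-a * ((-a - 1) * s ^ (-a - 1 - 1))) = -4 * a * (-a - 1) * (s * s ^ (-a - 1 - 1)) := by
    ring
  rw [this, e]
  ring

/-- **`□_η` of the DR weight**: for `ϖ(y) = 4 (s^{−1/2} − s^{−(1+δ)/2} + (δ/2) s^{−(1+2δ)/2})`
(`= 4/r − 4r^{−1−δ} + 2δ r^{−1−2δ}`) and `s = |y⃗|²(x) > 0`: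
`□_η ϖ (x) = 4 ( −δ(1+δ) s^{−(3+δ)/2} + δ²(1+2δ) s^{−(3+2δ)/2} )`.
[cite: DafermosRodnianski2010, §6] -/
theorem waveOperator_eta_largeRWeight (δ : ℝ) {x : E4} (hx : 0 < E4.spatialNorm x) :
    waveOperator (fun _ ↦ Kerr.etaComp) (fun y ↦ 4 * ((E4.spatialNorm y ^ 2) ^ (-(1 / 2 : ℝ)) -
        (E4.spatialNorm y ^ 2) ^ (-((1 + δ) / 2)) +
          δ / 2 * (E4.spatialNorm y ^ 2) ^ (-((1 + 2 * δ) / 2)))) x =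
      4 * (-(δ * (1 + δ)) * (E4.spatialNorm x ^ 2) ^ (-((1 + δ) / 2) - 1) +
        δ ^ 2 * (1 + 2 * δ) * (E4.spatialNorm x ^ 2) ^ (-((1 + 2 * δ) / 2) - 1)) := by
  set s : ℝ := E4.spatialNorm x ^ 2 with hs_def
  have hs : 0 < s := by positivity
  -- the weight as a function of `s`, and its derivatives
  obtain ⟨φ, hφ⟩ : ∃ φ : ℝ → ℝ, ∀ t, φ t = 4 * (t ^ (-(1 / 2 : ℝ)) - t ^ (-((1 + δ) / 2)) +
      δ / 2 * t ^ (-((1 + 2 * δ) / 2))) := ⟨_, fun _ ↦ rfl⟩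
  have hfun : (fun y : E4 ↦ 4 * ((E4.spatialNorm y ^ 2) ^ (-(1 / 2 : ℝ)) -
      (E4.spatialNorm y ^ 2) ^ (-((1 + δ) / 2)) +
        δ / 2 * (E4.spatialNorm y ^ 2) ^ (-((1 + 2 * δ) / 2)))) = fun y ↦ φ (E4.spatialNorm y ^ 2) :=
    funext fun y ↦ (hφ _).symm
  have hφfun : φ = fun t ↦ 4 * (t ^ (-(1 / 2 : ℝ)) - t ^ (-((1 + δ) / 2)) +
      δ / 2 * t ^ (-((1 + 2 * δ) / 2))) := funext hφ
  have hpow : ∀ (b : ℝ) {t : ℝ}, 0 < t → HasDerivAt (fun u : ℝ ↦ u ^ (-b)) (-b * t ^ (-b - 1)) t :=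
    fun b t ht ↦ Real.hasDerivAt_rpow_const (Or.inl ht.ne')
  have hφd : ∀ {t : ℝ}, 0 < t → HasDerivAt φ (4 * (-(1 / 2 : ℝ) * t ^ (-(1 / 2 : ℝ) - 1) -
      -((1 + δ) / 2) * t ^ (-((1 + δ) / 2) - 1) +
        δ / 2 * (-((1 + 2 * δ) / 2) * t ^ (-((1 + 2 * δ) / 2) - 1)))) t := by
    intro t ht
    rw [hφfun]
    exact (((hpow _ ht).sub (hpow _ ht)).add ((hpow _ ht).const_mul _)).const_mul 4
  have hcont : ContDiffAt ℝ 2 φ s := by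
    rw [hφfun]
    have h := fun b : ℝ ↦ (Real.contDiffAt_rpow_const_of_ne (p := -b) (n := 2) hs.ne')
    exact contDiffAt_const.mul (((h _).sub (h _)).add (contDiffAt_const.mul (h _)))
  rw [hfun, waveOperator_eta_radial hcont]
  simp only [← hs_def]
  -- `deriv φ` near `s` and `deriv (deriv φ)` at `s`
  obtain ⟨φ1, hφ1⟩ : ∃ φ1 : ℝ → ℝ, ∀ t, φ1 t = 4 * (-(1 / 2 : ℝ) * t ^ (-(1 / 2 : ℝ) - 1) -
      -((1 + δ) / 2) * t ^ (-((1 + δ) / 2) - 1) +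
        δ / 2 * (-((1 + 2 * δ) / 2) * t ^ (-((1 + 2 * δ) / 2) - 1))) := ⟨_, fun _ ↦ rfl⟩
  have hd1 : deriv φ =ᶠ[𝓝 s] φ1 := by
    filter_upwards [Ioi_mem_nhds hs] with t ht
    rw [hφ1]; exact (hφd ht).deriv
  have hφ' : deriv φ s = φ1 s := by rw [hφ1]; exact (hφd hs).deriv
  have hpow' : ∀ (b : ℝ), HasDerivAt (fun u : ℝ ↦ u ^ (-b - 1)) ((-b - 1) * s ^ (-b - 1 - 1)) s :=
    fun b ↦ Real.hasDerivAt_rpow_const (Or.inl hs.ne')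
  have hφ1d : HasDerivAt φ1 (4 * (-(1 / 2 : ℝ) * ((-(1 / 2 : ℝ) - 1) * s ^ (-(1 / 2 : ℝ) - 1 - 1)) -
      -((1 + δ) / 2) * ((-((1 + δ) / 2) - 1) * s ^ (-((1 + δ) / 2) - 1 - 1)) +
        δ / 2 * (-((1 + 2 * δ) / 2) * ((-((1 + 2 * δ) / 2) - 1) *
          s ^ (-((1 + 2 * δ) / 2) - 1 - 1))))) s := by
    have hφ1fun : φ1 = fun t ↦ 4 * (-(1 / 2 : ℝ) * t ^ (-(1 / 2 : ℝ) - 1) -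
        -((1 + δ) / 2) * t ^ (-((1 + δ) / 2) - 1) +
          δ / 2 * (-((1 + 2 * δ) / 2) * t ^ (-((1 + 2 * δ) / 2) - 1))) := funext hφ1
    rw [hφ1fun]
    exact ((((hpow' _).const_mul _).sub ((hpow' _).const_mul _)).add
      (((hpow' _).const_mul _).const_mul _)).const_mul 4
  have hφ'' : deriv (deriv φ) s = 4 * (-(1 / 2 : ℝ) * ((-(1 / 2 : ℝ) - 1) * s ^ (-(1 / 2 : ℝ) - 1 - 1)) -
      -((1 + δ) / 2) * ((-((1 + δ) / 2) - 1) * s ^ (-((1 + δ) / 2) - 1 - 1)) +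
        δ / 2 * (-((1 + 2 * δ) / 2) * ((-((1 + 2 * δ) / 2) - 1) *
          s ^ (-((1 + 2 * δ) / 2) - 1 - 1)))) := by
    rw [hd1.deriv_eq]; exact hφ1d.deriv
  rw [hφ', hφ'', hφ1]
  -- collect: `s · s^{c-1} = s^c`
  have e1 : s * s ^ (-(1 / 2 : ℝ) - 1 - 1) = s ^ (-(1 / 2 : ℝ) - 1) := mul_rpow_sub_one hs _
  have e2 : s * s ^ (-((1 + δ) / 2) - 1 - 1) = s ^ (-((1 + δ) / 2) - 1) := mul_rpow_sub_one hs _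
  have e3 : s * s ^ (-((1 + 2 * δ) / 2) - 1 - 1) = s ^ (-((1 + 2 * δ) / 2) - 1) :=
    mul_rpow_sub_one hs _
  have key : 4 * s * (4 * (-(1 / 2 : ℝ) * ((-(1 / 2 : ℝ) - 1) * s ^ (-(1 / 2 : ℝ) - 1 - 1)) -
      -((1 + δ) / 2) * ((-((1 + δ) / 2) - 1) * s ^ (-((1 + δ) / 2) - 1 - 1)) +
        δ / 2 * (-((1 + 2 * δ) / 2) * ((-((1 + 2 * δ) / 2) - 1) * s ^ (-((1 + 2 * δ) / 2) - 1 - 1))))) =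
      16 * (-(1 / 2 : ℝ) * (-(1 / 2 : ℝ) - 1) * (s * s ^ (-(1 / 2 : ℝ) - 1 - 1)) -
        -((1 + δ) / 2) * (-((1 + δ) / 2) - 1) * (s * s ^ (-((1 + δ) / 2) - 1 - 1)) +
          δ / 2 * (-((1 + 2 * δ) / 2) * (-((1 + 2 * δ) / 2) - 1)) *
            (s * s ^ (-((1 + 2 * δ) / 2) - 1 - 1))) := by ring
  rw [key, e1, e2, e3]
  ring

/-- **The zeroth-order term is positive for `r ≥ 2^{1/δ}`**: with `ϖ` the DR weight and
`0 < δ ≤ 1`, `r = |y⃗|(x) ≥ 2^{1/δ}`,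
`−⅛ □_η ϖ (x) ≥ (δ/4) r^{−3−δ}` (since `−⅛ □_η ϖ = ½ δ r^{−3−δ} ((1+δ) − δ(1+2δ) r^{−δ})` and
`δ(1+2δ) r^{−δ} ≤ (δ + 2δ²)/2`, the bracket is `≥ ½ + δ/2 − δ² ≥ ½`).
[cite: DafermosRodnianski2010, §6] -/
theorem largeR_zerothOrder_lower_bound {δ : ℝ} (hδ0 : 0 < δ) (hδ1 : δ ≤ 1) {x : E4}
    (hx : (2 : ℝ) ^ (1 / δ) ≤ E4.spatialNorm x) :
    δ / 4 * E4.spatialNorm x ^ (-3 - δ) ≤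
      -8⁻¹ * waveOperator (fun _ ↦ Kerr.etaComp) (fun y ↦ 4 * ((E4.spatialNorm y ^ 2) ^ (-(1 / 2 : ℝ)) -
        (E4.spatialNorm y ^ 2) ^ (-((1 + δ) / 2)) +
          δ / 2 * (E4.spatialNorm y ^ 2) ^ (-((1 + 2 * δ) / 2)))) x := by
  have h2 : 0 < (2 : ℝ) ^ (1 / δ) := Real.rpow_pos_of_pos (by norm_num) _
  have hr : 0 < E4.spatialNorm x := h2.trans_le hx
  set r : ℝ := E4.spatialNorm x with hr_def
  rw [waveOperator_eta_largeRWeight δ hr]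
  -- convert the powers of `s = r²` into powers of `r`
  simp only [← hr_def]
  have hB : (r ^ 2) ^ (-((1 + δ) / 2) - 1) = r ^ (-3 - δ) := by
    rw [← Real.rpow_two, ← Real.rpow_mul hr.le]; ring_nf
  have hC : (r ^ 2) ^ (-((1 + 2 * δ) / 2) - 1) = r ^ (-3 - δ) * r ^ (-δ) := by
    rw [← Real.rpow_two, ← Real.rpow_mul hr.le, ← Real.rpow_add hr]; ring_nf
  rw [hB, hC]
  have hu := rpow_neg_le_half hδ0 hx
  have hu0 : 0 < r ^ (-δ) := Real.rpow_pos_of_pos hr _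
  have hB0 : 0 < r ^ (-3 - δ) := Real.rpow_pos_of_pos hr _
  -- the bracket `(1+δ) − δ(1+2δ)u` is at least `½ + δ/2 − δ² ≥ ½`
  have hδ2 : δ ^ 2 ≤ δ := by nlinarith
  have hδ3 : δ ^ 3 ≤ δ ^ 2 := by nlinarith
  have h1 : δ * (1 + 2 * δ) * r ^ (-δ) ≤ δ * (1 + 2 * δ) * (1 / 2) :=
    mul_le_mul_of_nonneg_left hu (by positivity)
  have hkey : δ / 4 ≤ 2⁻¹ * δ * (1 + δ) - 2⁻¹ * δ * (δ * (1 + 2 * δ) * r ^ (-δ)) := by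
    nlinarith [mul_le_mul_of_nonneg_left h1 hδ0.le]
  calc δ / 4 * r ^ (-3 - δ) ≤ (2⁻¹ * δ * (1 + δ) - 2⁻¹ * δ * (δ * (1 + 2 * δ) * r ^ (-δ))) *
        r ^ (-3 - δ) := mul_le_mul_of_nonneg_right hkey hB0.le
    _ = _ := by ring

end KerrSchild

end Literature.Geometry.Lorentzian
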